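import Summits.AtomisticToContinuum.HydrodynamicLimit.Theorems.OneFlightGossipEngineEnergyCurrentTailsLevelCensusObjects
import Literature.MathematicalPhysics.KineticTheory.HardSphereTwoTimePressure
import HarnessLib

/-!
# Census closure, tools II: velocity-event counts — monotonicity, subadditivity, measurability
# (stub C of the line `level-census-comparison`, crux `EnergyCurrentTails`, stmt-AtomisticToContinuum-9235)

Helper file of the registered stub `stub_censusClosure` (line lead's seat c2; registered main
theorem `eventCount_mono`, `∀`-form) over the line's vocabulary `…LevelCensusObjects`:
* on the good set of the flow the pathwise event count `eventSum Φ s s' S z` is an honest finite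
  sum over the collision records of the window (`HardSphereFlow.finite_collisionTimes_inter`,
  `collisionSum_eq_finset_sum`), hence MONOTONE and SUBADDITIVE in the account `S`; the good set is
  `λ_N`-conull (`ae_mem_good_localGibbsLaw`), so the expected counts `eventCount` are monotone, and
  subadditive over unions GIVEN the a.e.-measurability of the summands (stub A (iv);
  `lintegral_add_right'`);
* the accounts `shellEvent`, `tailEvent`, `upEvent`, `downEvent`, `mergeEvent`, `splitEvent` are
  Borel sets of velocity events;
* the two account inclusions of the closure, copied from the line's skeleton §1:
  `splitEvent E ⊆ downEvent E` and `upEvent E ⊆ shellEvent (E−Δ) E ∪ mergeEvent E Δ ∪ tailEvent (4E)`.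
Nothing is defined; no kinematics beyond these inclusions is used.
-/

noncomputable section

open MeasureTheory Set Filter
open scoped ENNReal InnerProductSpace

namespace Summit.AtomisticToContinuum.HydrodynamicLimit.Theorems.EnergyCurrentTailsLevelCensus

open Literature.MathematicalPhysics.KineticTheory Literature.Analysis.FluidPDE

variable {σ : ℝ} {a₀ θ₀ : T3 → ℝ} {u₀ : T3 → V3} {N : ℕ}

/-! ## Pathwise monotonicity and subadditivity on the good set -/

/-- On the good set the event count is monotone in the account. -/
theorem eventSum_mono {Φ : Flow σ N} {z : Config (N + 1) (Fin 3) T3} (hz : z ∈ Φ.good) (s s' : ℝ)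
    {S T : Set VelEvent} (hST : S ⊆ T) : eventSum Φ s s' S z ≤ eventSum Φ s s' T z := by
  unfold eventSum
  have hfin := Φ.finite_collisionTimes_inter hz (Set.Ioc_subset_Icc_self (a := s) (b := s'))
  rw [Φ.collisionSum_eq, Φ.collisionSum_eq, collisionSum_eq_finset_sum hfin,
    collisionSum_eq_finset_sum hfin]
  refine Finset.sum_le_sum fun t _ => Finset.sum_le_sum fun p _ => ?_
  split_ifs
  · exact Set.indicator_le_indicator_of_subset hST (fun _ => zero_le_one) _
  · exact le_rfl

/-- On the good set the event count is subadditive over unions of accounts. -/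
theorem eventSum_union_le {Φ : Flow σ N} {z : Config (N + 1) (Fin 3) T3} (hz : z ∈ Φ.good)
    (s s' : ℝ) (S T : Set VelEvent) :
    eventSum Φ s s' (S ∪ T) z ≤ eventSum Φ s s' S z + eventSum Φ s s' T z := by
  unfold eventSum
  have hfin := Φ.finite_collisionTimes_inter hz (Set.Ioc_subset_Icc_self (a := s) (b := s'))
  rw [Φ.collisionSum_eq, Φ.collisionSum_eq, Φ.collisionSum_eq, collisionSum_eq_finset_sum hfin,
    collisionSum_eq_finset_sum hfin, collisionSum_eq_finset_sum hfin, ← Finset.sum_add_distrib]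
  refine Finset.sum_le_sum fun t _ => ?_
  rw [← Finset.sum_add_distrib]
  refine Finset.sum_le_sum fun p _ => ?_
  split_ifs
  · calc Set.indicator (S ∪ T) (fun _ => (1 : ℝ≥0∞)) _
        ≤ Set.indicator (S ∪ T) (fun _ => (1 : ℝ≥0∞)) _ + Set.indicator (S ∩ T) (fun _ => (1 : ℝ≥0∞)) _ :=
          le_self_add
      _ = _ := Set.indicator_union_add_inter_apply _ _ _ _
  · simp

/-! ## Expected counts -/

/-- **Monotonicity of the expected event count in the account (registered main theorem of this
file, `∀`-form)**: `S ⊆ T → eventCount … S ≤ eventCount … T`. -/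
theorem eventCount_mono :
    ∀ (σ : ℝ) (a₀ θ₀ : T3 → ℝ) (u₀ : T3 → V3) (N : ℕ) (Φ : Flow σ N) (s s' : ℝ) (S T : Set VelEvent),
      S ⊆ T → eventCount σ a₀ θ₀ u₀ N Φ s s' S ≤ eventCount σ a₀ θ₀ u₀ N Φ s s' T := by
  intro σ a₀ θ₀ u₀ N Φ s s' S T hST
  unfold eventCount
  exact lintegral_mono_ae ((ae_mem_good_localGibbsLaw σ a₀ u₀ θ₀ N Φ).mono
    fun z hz => eventSum_mono hz s s' hST)

/-- **Subadditivity of the expected event count over a union**, given the a.e.-measurability of the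
second summand (stub A (iv)). -/
theorem eventCount_union_le (Φ : Flow σ N) (s s' : ℝ) (S T : Set VelEvent)
    (hT : AEMeasurable (eventSum Φ s s' T) (localGibbsLaw σ a₀ u₀ θ₀ N Φ)) :
    eventCount σ a₀ θ₀ u₀ N Φ s s' (S ∪ T)
      ≤ eventCount σ a₀ θ₀ u₀ N Φ s s' S + eventCount σ a₀ θ₀ u₀ N Φ s s' T := by
  unfold eventCount
  rw [← lintegral_add_right' _ hT]
  exact lintegral_mono_ae ((ae_mem_good_localGibbsLaw σ a₀ u₀ θ₀ N Φ).mono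
    fun z hz => eventSum_union_le hz s s' S T)

/-- Subadditivity over a union of three accounts. -/
theorem eventCount_union₃_le (Φ : Flow σ N) (s s' : ℝ) (S T V : Set VelEvent)
    (hT : AEMeasurable (eventSum Φ s s' T) (localGibbsLaw σ a₀ u₀ θ₀ N Φ))
    (hV : AEMeasurable (eventSum Φ s s' V) (localGibbsLaw σ a₀ u₀ θ₀ N Φ)) :
    eventCount σ a₀ θ₀ u₀ N Φ s s' (S ∪ T ∪ V)
      ≤ eventCount σ a₀ θ₀ u₀ N Φ s s' S + eventCount σ a₀ θ₀ u₀ N Φ s s' T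
        + eventCount σ a₀ θ₀ u₀ N Φ s s' V :=
  (eventCount_union_le Φ s s' (S ∪ T) V hV).trans
    (add_le_add (eventCount_union_le Φ s s' S T hT) le_rfl)

/-! ## The accounts are Borel -/

/-- `q ↦ ‖q.1.1‖²` is measurable on velocity events. -/
theorem measurable_pre_fst : Measurable fun q : VelEvent => ‖q.1.1‖ ^ 2 :=
  (measurable_fst.fst.norm).pow_const 2

/-- `q ↦ ‖q.1.2‖²` is measurable on velocity events. -/
theorem measurable_pre_snd : Measurable fun q : VelEvent => ‖q.1.2‖ ^ 2 :=
  (measurable_fst.snd.norm).pow_const 2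

/-- `q ↦ ‖q.2.1‖²` is measurable on velocity events. -/
theorem measurable_post_fst : Measurable fun q : VelEvent => ‖q.2.1‖ ^ 2 :=
  (measurable_snd.fst.norm).pow_const 2

/-- `q ↦ ‖q.2.2‖²` is measurable on velocity events. -/
theorem measurable_post_snd : Measurable fun q : VelEvent => ‖q.2.2‖ ^ 2 :=
  (measurable_snd.snd.norm).pow_const 2

/-- `maxPre` is measurable. -/
theorem measurable_maxPre : Measurable maxPre :=
  measurable_pre_fst.max measurable_pre_snd

/-- The shell account is Borel. -/
theorem measurableSet_shellEvent (E₁ E₂ : ℝ) : MeasurableSet (shellEvent E₁ E₂) :=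
  ((measurableSet_lt measurable_const measurable_pre_fst).inter
      (measurableSet_le measurable_pre_fst measurable_const)).union
    ((measurableSet_lt measurable_const measurable_pre_snd).inter
      (measurableSet_le measurable_pre_snd measurable_const))

/-- The tail account is Borel. -/
theorem measurableSet_tailEvent (Y : ℝ) : MeasurableSet (tailEvent Y) :=
  measurableSet_lt measurable_const measurable_maxPre

/-- The real-valued count above a level of a pair of velocities is measurable. -/
theorem measurable_aboveCount_real (E : ℝ) :
    Measurable fun p : V3 × V3 => ((aboveCount E p : ℕ) : ℝ) := by
  have h1 : Measurable fun p : V3 × V3 => ‖p.1‖ ^ 2 := (measurable_fst.norm).pow_const 2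
  have h2 : Measurable fun p : V3 × V3 => ‖p.2‖ ^ 2 := (measurable_snd.norm).pow_const 2
  have h : (fun p : V3 × V3 => ((aboveCount E p : ℕ) : ℝ))
      = fun p => (if E < ‖p.1‖ ^ 2 then (1 : ℝ) else 0) + (if E < ‖p.2‖ ^ 2 then (1 : ℝ) else 0) := by
    ext p; simp only [aboveCount]; push_cast [Nat.cast_ite]; ring
  rw [h]
  refine Measurable.add ?_ ?_
  · exact Measurable.ite (measurableSet_lt measurable_const h1) measurable_const measurable_const
  · exact Measurable.ite (measurableSet_lt measurable_const h2) measurable_const measurable_const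

/-- The up-crossing account is Borel. -/
theorem measurableSet_upEvent (E : ℝ) : MeasurableSet (upEvent E) := by
  have h : upEvent E = {q : VelEvent | ((aboveCount E q.1 : ℕ) : ℝ) < ((aboveCount E q.2 : ℕ) : ℝ)} := by
    ext q; simp only [upEvent, Set.mem_setOf_eq, Nat.cast_lt]
  rw [h]
  exact measurableSet_lt ((measurable_aboveCount_real E).comp measurable_fst)
    ((measurable_aboveCount_real E).comp measurable_snd)

/-- The down-crossing account is Borel. -/
theorem measurableSet_downEvent (E : ℝ) : MeasurableSet (downEvent E) := by
  have h : downEvent E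
      = {q : VelEvent | ((aboveCount E q.2 : ℕ) : ℝ) < ((aboveCount E q.1 : ℕ) : ℝ)} := by
    ext q; simp only [downEvent, Set.mem_setOf_eq, Nat.cast_lt]
  rw [h]
  exact measurableSet_lt ((measurable_aboveCount_real E).comp measurable_snd)
    ((measurable_aboveCount_real E).comp measurable_fst)

/-- The merge/spallation account is Borel. -/
theorem measurableSet_mergeEvent (E Δ : ℝ) : MeasurableSet (mergeEvent E Δ) :=
  ((measurableSet_upEvent E).inter (measurableSet_shellEvent _ _).compl).inter
    (measurableSet_le measurable_maxPre measurable_const)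

/-- The splitting account is Borel. -/
theorem measurableSet_splitEvent (E : ℝ) : MeasurableSet (splitEvent E) :=
  (measurableSet_lt measurable_const measurable_maxPre).inter
    ((measurableSet_le measurable_maxPre measurable_const).inter
      ((measurableSet_le measurable_post_fst measurable_const).inter
        (measurableSet_le measurable_post_snd measurable_const)))

/-! ## The two account inclusions of the closure (skeleton §1) -/

/-- Splitting collisions are down-crossings: `splitEvent E ⊆ downEvent E`. -/
theorem splitEvent_subset_downEvent (E : ℝ) : splitEvent E ⊆ downEvent E := by
  rintro ⟨⟨v, w⟩, ⟨v', w'⟩⟩ ⟨hmax, -, hv', hw'⟩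
  simp only [downEvent, Set.mem_setOf_eq, aboveCount, maxPre] at *
  have h1 : ¬ E < ‖v'‖ ^ 2 := not_lt.2 hv'
  have h2 : ¬ E < ‖w'‖ ^ 2 := not_lt.2 hw'
  simp only [h1, h2, if_false, add_zero]
  rcases lt_max_iff.1 hmax with h | h
  · simp [h]
  · simp only [h, if_true]
    split <;> simp

/-- Every up-crossing at level `E` is in one of the three accounts: a participant in the band
`(E−Δ, E]` (F1), a merge/spallation pair event with faster participant `≤ 4E` (F2), or a collision
involving a participant above `4E` (F1's tail). -/
theorem upEvent_subset_accounts (E Δ : ℝ) :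
    upEvent E ⊆ shellEvent (E - Δ) E ∪ mergeEvent E Δ ∪ tailEvent (4 * E) := by
  intro q hq
  by_cases hb : q ∈ shellEvent (E - Δ) E
  · exact Or.inl (Or.inl hb)
  · by_cases ht : maxPre q ≤ 4 * E
    · exact Or.inl (Or.inr ⟨⟨hq, hb⟩, ht⟩)
    · exact Or.inr (not_le.1 ht)

end Summit.AtomisticToContinuum.HydrodynamicLimit.Theorems.EnergyCurrentTailsLevelCensus

end
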